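import Mathlib.LinearAlgebra.Trace
import Mathlib.RingTheory.TensorProduct.Free
import Literature.NumberTheory.Automorphic.QuaternionAlgebraAdelic
import HarnessLib

/-!
# Reduced trace, standard involution and reduced norm commute with base change

Topic `NumberTheory/Automorphic`; theorems only (no definition, no named fact, no instance).
For a finite-dimensional algebra `D` over a field `K` and a field extension `F/K`, the tree's
`leftMulTrace`, `reducedTrace`, `standardInvolution`, `reducedNorm` (`QuaternionAlgebraAdelic.lean`)
of the base change `D_F = F ⊗_K D` restrict to those of `D` along `x ↦ 1 ⊗ x`:

* `leftMulTrace_one_tmul` — `Tr_{D_F/F}(1 ⊗ x) = Tr_{D/K}(x)` (left multiplication by `1 ⊗ x`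
  is the base change of left multiplication by `x`; Mathlib `LinearMap.trace_baseChange`);
* `reducedTrace_one_tmul`, `standardInvolution_one_tmul` (`(1 ⊗ x)‾ = 1 ⊗ x̄`),
  `reducedNorm_one_tmul` — `trd`, `x ↦ x̄`, `nrd` likewise;
* the same for the type synonym `ScalarExtension K F D` and its embedding `incl`
  (`leftMulTrace_incl`, `reducedTrace_incl`, `standardInvolution_incl`, `reducedNorm_incl`):
  e.g. **`nrd_{D_v}(x) = nrd_D(x)` in `K_v` for `x ∈ D`** (Vignéras III §1: the reduced norm of
  `H_v = H ⊗ K_v` extends that of `H`), the compatibility used to read local integrality of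
  global elements.

## References

* M.-F. Vignéras, *Arithmétique des algèbres de quaternions*, LNM 800 (1980), Ch. I §1–2
  (`H_F = F ⊗ H`), Ch. III §1 [VignerasLNM800].
-/

noncomputable section

open scoped TensorProduct

namespace Literature.NumberTheory.Automorphic

section TensorProduct

variable (K : Type*) [Field K] (F : Type*) [Field F] [Algebra K F]
  (D : Type*) [Ring D] [Algebra K D]

/-- Left multiplication by `1 ⊗ x` on `F ⊗_K D` is the base change of left multiplication by `x`. [folklore] -/
theorem lmul_one_tmul_eq_baseChange (x : D) :
    ((Algebra.lmul F (F ⊗[K] D) ((1 : F) ⊗ₜ[K] x) : F ⊗[K] D →ₗ[F] F ⊗[K] D) : F ⊗[K] D → F ⊗[K] D) =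
      (Algebra.lmul K D x).baseChange F := by
  funext y
  change ((1 : F) ⊗ₜ[K] x) * y = (Algebra.lmul K D x).baseChange F y
  induction y using TensorProduct.induction_on with
  | zero => simp
  | tmul a b => rw [LinearMap.baseChange_tmul, Algebra.TensorProduct.tmul_mul_tmul, one_mul]; rfl
  | add y z hy hz => rw [mul_add, map_add, hy, hz]

/-- **`Tr_{D_F/F}(1 ⊗ x) = Tr_{D/K}(x)`**: the left-multiplication trace commutes with base
change (for `D` finite-dimensional over `K`). [folklore] -/
theorem leftMulTrace_one_tmul [Module.Finite K D] (x : D) :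
    leftMulTrace F (F ⊗[K] D) ((1 : F) ⊗ₜ[K] x) = algebraMap K F (leftMulTrace K D x) := by
  haveI : Module.Free K D := Module.Free.of_divisionRing K D
  rw [leftMulTrace_apply, leftMulTrace_apply]
  have h : (Algebra.lmul F (F ⊗[K] D) ((1 : F) ⊗ₜ[K] x) : F ⊗[K] D →ₗ[F] F ⊗[K] D) =
      (Algebra.lmul K D x).baseChange F :=
    LinearMap.ext fun y => congrFun (lmul_one_tmul_eq_baseChange K F D x) y
  rw [h, LinearMap.trace_baseChange]

/-- `trd_{D_F}(1 ⊗ x) = trd_D(x)`. [folklore] -/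
theorem reducedTrace_one_tmul [Module.Finite K D] (x : D) :
    reducedTrace F (F ⊗[K] D) ((1 : F) ⊗ₜ[K] x) = algebraMap K F (reducedTrace K D x) := by
  simp only [reducedTrace, LinearMap.smul_apply, leftMulTrace_one_tmul, smul_eq_mul, map_mul,
    map_inv₀, map_ofNat]

/-- `1 ⊗ (c · 1_D) = (c · 1_F) ⊗ 1 = algebraMap F (F ⊗ D) (algebraMap K F c)`: scalars of `K`
inside the base change. [folklore] -/
theorem one_tmul_algebraMap (c : K) :
    (1 : F) ⊗ₜ[K] algebraMap K D c = algebraMap F (F ⊗[K] D) (algebraMap K F c) := by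
  rw [Algebra.TensorProduct.algebraMap_apply, Algebra.algebraMap_self_apply,
    Algebra.algebraMap_eq_smul_one, Algebra.algebraMap_eq_smul_one, TensorProduct.smul_tmul]

/-- **`(1 ⊗ x)‾ = 1 ⊗ x̄`**: the standard involution commutes with base change. [folklore] -/
theorem standardInvolution_one_tmul [Module.Finite K D] (x : D) :
    standardInvolution F (F ⊗[K] D) ((1 : F) ⊗ₜ[K] x) = (1 : F) ⊗ₜ[K] standardInvolution K D x := by
  rw [standardInvolution, standardInvolution, reducedTrace_one_tmul, TensorProduct.tmul_sub,
    one_tmul_algebraMap]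

/-- **`nrd_{D_F}(1 ⊗ x) = nrd_D(x)`**: the reduced norm commutes with base change. [folklore] -/
theorem reducedNorm_one_tmul [Module.Finite K D] (x : D) :
    reducedNorm F (F ⊗[K] D) ((1 : F) ⊗ₜ[K] x) = algebraMap K F (reducedNorm K D x) := by
  rw [reducedNorm, reducedNorm, standardInvolution_one_tmul, Algebra.TensorProduct.tmul_mul_tmul,
    one_mul, leftMulTrace_one_tmul, (algebraMap K F).map_mul, map_inv₀, map_ofNat]

end TensorProduct

/-! ### The type synonym `ScalarExtension K F D` and `incl : D → D_F` -/

namespace ScalarExtension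

variable (K : Type*) [Field K] (F : Type*) [Field F] [Algebra K F]
  (D : Type*) [Ring D] [Algebra K D] [Module.Finite K D]

/-- `Tr_{D_F/F}(incl x) = Tr_{D/K}(x)` on `ScalarExtension K F D`. [folklore] -/
theorem leftMulTrace_incl (x : D) :
    leftMulTrace F (ScalarExtension K F D) (incl K F D x) = algebraMap K F (leftMulTrace K D x) :=
  leftMulTrace_one_tmul K F D x

/-- `trd_{D_F}(incl x) = trd_D(x)`. [folklore] -/
theorem reducedTrace_incl (x : D) :
    reducedTrace F (ScalarExtension K F D) (incl K F D x) = algebraMap K F (reducedTrace K D x) :=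
  reducedTrace_one_tmul K F D x

/-- `(incl x)‾ = incl x̄`. [folklore] -/
theorem standardInvolution_incl (x : D) :
    standardInvolution F (ScalarExtension K F D) (incl K F D x) = incl K F D (standardInvolution K D x) :=
  standardInvolution_one_tmul K F D x

/-- **`nrd_{D_F}(incl x) = nrd_D(x)`** (Vignéras III §1: the reduced norm of `H_v` extends that of
`H`). [cite: VignerasLNM800, Ch. III §1] -/
theorem reducedNorm_incl (x : D) :
    reducedNorm F (ScalarExtension K F D) (incl K F D x) = algebraMap K F (reducedNorm K D x) :=
  reducedNorm_one_tmul K F D x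

end ScalarExtension

end Literature.NumberTheory.Automorphic

end
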